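import Summits.QuantumFields.YangMills.Theorems.SteinGapBootstrapFreeProbeLawGStubSdRate
import Summits.QuantumFields.YangMills.Theorems.SteinGapBootstrapFreeProbeLawGBlockGreenCurl
import HarnessLib

/-!
# Crux U `FreeProbeLawG` (stmt-QuantumFields-23756), line `birth` — Green resummation of the single-edge Schwinger–Dyson identity

Route `SteinGapBootstrap` of `QuantumFields/YangMills` (width seat `ym-line-sgb-p1-w2`; def-free helper for the lead's `stub_assembly`
of the skeleton `Cruxes/FreeProbeLawG/Lines/birth.lean`). HONEST LABEL: the route serves the RECORD-label rung R2ξ-G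
(`WeakCouplingRates.XiPow`, an UPPER bound on the lattice gap); nothing here bears on the Yang–Mills mass gap itself.

`SdRate.sd_resum`: summing the single-edge Schwinger–Dyson identities (registered stub `stub_sdRate`, landed:
`Theorems/SteinGapBootstrapFreeProbeLawGStubSdRate.lean`) of the links `e` of a finite edge set `T` against a `1`-form `ω` supported in `T`
gives, for every colour `a` and every `C¹` block test `g` on `Y_S` with `‖∇g‖ ≤ M` (no bound on `g` itself is needed),

  `|E_μ[∇g(Y_S) · v_{ω,a}] − E_μ[g(Y_S) · ∑_{p∈S} (dω)_p Y_p^a]| ≤ (∑_{e∈T} |ω e|) · R`,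

where `v_{ω,a} = fun q b => [b = a] (dω)_q` and `R` bounds each single-edge defect (hypothesis `hsd`, the opened conclusion of `stub_sdRate`):
pure linearity — `(dω)_q = ∑_{e∈T} ω(e) (dδ_e)_q` (`BlockGreen.plaquetteCurl_eq_sum_of_support`), the Fréchet derivative is linear in
the direction, finite sums pass through the integrals. `SdRate.plaquettesTouching_singleton_subset` supplies the support hypothesis of
`stub_sdRate` for the links of `T`. With the box-truncated Green `1`-form of `stub_blockGreen` this is the Stein-pair input
`E[∂_v G] ≈ E[G · Z_a]`, `Z_a = ⟨dω, Y^a⟩`, of the lead's assembly.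

Reference: S. Chatterjee, arXiv:1602.01222 §11. [arXiv160201222]
-/

set_option autoImplicit false

noncomputable section

open MeasureTheory Filter Topology
open Literature.Probability.LatticeModels Literature.MathematicalPhysics.QuantumLattice
open Literature.MathematicalPhysics.QuantumFieldTheory hiding ZdEdge IsLocalObservable IsInfiniteVolumeLimit
open Summit.QuantumFields.YangMills.Theorems.EquipartitionPinsProbe
open Summit.QuantumFields.YangMills.Theorems.EquipartitionPinsProbe.TangentSteinFiniteBeta
open Summit.QuantumFields.YangMills.Theorems.SteinGapBootstrap

namespace Summit.QuantumFields.YangMills.Cruxes.FreeProbeLawG.SteinFree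

namespace SdRate

/-- Monotonicity of `plaquettesTouching` for a link of a finite edge set: `e ∈ T → plaquettesTouching {e} ⊆ plaquettesTouching T`
(supplies the support hypothesis of `stub_sdRate` for every link of `T` once `plaquettesTouching T ⊆ S`). -/
theorem plaquettesTouching_singleton_subset {T : Finset (Literature.MathematicalPhysics.QuantumLattice.ZdEdge 4)}
    {e : Literature.MathematicalPhysics.QuantumLattice.ZdEdge 4} (he : e ∈ T) :
    plaquettesTouching ({e} : Finset (Literature.MathematicalPhysics.QuantumLattice.ZdEdge 4)) ⊆ plaquettesTouching T := by
  intro p hp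
  rw [mem_plaquettesTouching_iff] at hp ⊢
  obtain ⟨f, hf⟩ := hp
  rw [Finset.mem_inter, Finset.mem_singleton] at hf
  exact ⟨f, Finset.mem_inter.2 ⟨hf.1, hf.2 ▸ he⟩⟩

section Resum

variable {G : Type} [Group G] [TopologicalSpace G] [IsTopologicalGroup G] [CompactSpace G]
  [MeasurableSpace G] [BorelSpace G] [SecondCountableTopology G]

/-- **Green resummation of the single-edge Schwinger–Dyson identities.** See the module docstring. -/
theorem sd_resum (r : LatticeRep G) (β : ℝ) (μ : Measure (LGConfig 4 G)) [IsFiniteMeasure μ]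
    (S : Finset (ZdPlaquette 4)) (a : Fin (lieDim r))
    (ω : Literature.MathematicalPhysics.QuantumLattice.ZdEdge 4 → ℝ) (T : Finset (Literature.MathematicalPhysics.QuantumLattice.ZdEdge 4))
    (hωT : ∀ e, ω e ≠ 0 → e ∈ T)
    (g : (↥S → Fin (lieDim r) → ℝ) → ℝ) (hg : ContDiff ℝ 1 g) {M : ℝ} (hgM : ∀ y, ‖fderiv ℝ g y‖ ≤ M)
    {R : ℝ}
    (hsd : ∀ e ∈ T,
      |(∑ p : ↥S, plaquetteCurl (fun e' => if e' = e then (1 : ℝ) else 0) (p : ZdPlaquette 4) *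
            ∫ U, fderiv ℝ g (fun q b => plaqField r β U (q : ZdPlaquette 4) b)
              (fun q b => if q = p ∧ b = a then (1 : ℝ) else 0) ∂μ) -
          ∫ U, g (fun q b => plaqField r β U (q : ZdPlaquette 4) b) *
            (∑ p ∈ S, plaquetteCurl (fun e' => if e' = e then (1 : ℝ) else 0) p * plaqField r β U p a) ∂μ| ≤ R) :
    |(∫ U, fderiv ℝ g (fun q b => plaqField r β U (q : ZdPlaquette 4) b)
          (fun q b => if b = a then plaquetteCurl ω (q : ZdPlaquette 4) else 0) ∂μ) -
        ∫ U, g (fun q b => plaqField r β U (q : ZdPlaquette 4) b) *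
          (∑ p ∈ S, plaquetteCurl ω p * plaqField r β U p a) ∂μ| ≤ (∑ e ∈ T, |ω e|) * R := by
  classical
  -- notation
  set YS : LGConfig 4 G → (↥S → Fin (lieDim r) → ℝ) := fun U q b => plaqField r β U q b with hYS
  set E : ↥S → (↥S → Fin (lieDim r) → ℝ) := fun p q b => if q = p ∧ b = a then (1 : ℝ) else 0 with hE
  set c : Literature.MathematicalPhysics.QuantumLattice.ZdEdge 4 → ZdPlaquette 4 → ℝ :=
    fun e p => plaquetteCurl (fun e' => if e' = e then (1 : ℝ) else 0) p with hc
  have hYSc : Continuous YS := continuous_pi fun q => continuous_pi fun b =>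
    TangentPlaqFieldContinuous.continuous_plaqField_apply r β (q : ZdPlaquette 4) b
  have hgc : Continuous g := hg.continuous
  have hfdc : Continuous (fderiv ℝ g) := hg.continuous_fderiv one_ne_zero
  have hM0 : 0 ≤ M := (norm_nonneg _).trans (hgM 0)
  -- `(dω)_q = Σ_{e∈T} ω(e) (dδ_e)_q`
  have hcurl : ∀ q : ZdPlaquette 4, plaquetteCurl ω q = ∑ e ∈ T, ω e * c e q := fun q =>
    BlockGreen.plaquetteCurl_eq_sum_of_support ω T hωT q
  -- integrability of the partial derivatives and of the products `g · Y_p^a`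
  have hEint : ∀ p : ↥S, Integrable (fun U => fderiv ℝ g (YS U) (E p)) μ := fun p => by
    have hcont : Continuous fun U => fderiv ℝ g (YS U) (E p) := (hfdc.comp hYSc).clm_apply continuous_const
    have hE1 : ‖E p‖ ≤ 1 := by
      refine (pi_norm_le_iff_of_nonneg zero_le_one).2 fun q => (pi_norm_le_iff_of_nonneg zero_le_one).2 fun b => ?_
      simp only [hE, Real.norm_eq_abs]
      split_ifs <;> simp
    refine Integrable.of_bound hcont.measurable.aestronglyMeasurable M (ae_of_all _ fun U => ?_)
    rw [Real.norm_eq_abs]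
    refine (abs_clm_apply_le _ (hgM _) _).trans ?_
    nlinarith [norm_nonneg (E p)]
  have hPint : ∀ p : ZdPlaquette 4, Integrable (fun U => g (YS U) * plaqField r β U p a) μ := fun p => by
    have hcont : Continuous fun U => g (YS U) * plaqField r β U p a :=
      (hgc.comp hYSc).mul (TangentPlaqFieldContinuous.continuous_plaqField_apply r β p a)
    obtain ⟨C, -, hC⟩ := exists_abs_le_of_continuous hcont
    exact Integrable.of_bound hcont.measurable.aestronglyMeasurable C (ae_of_all _ fun U => by rw [Real.norm_eq_abs]; exact hC U)
  -- the direction `v_{ω,a}` as a double combination of basis vectors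
  have hvec : (fun (q : ↥S) (b : Fin (lieDim r)) => if b = a then plaquetteCurl ω (q : ZdPlaquette 4) else 0) =
      ∑ e ∈ T, ω e • ∑ p : ↥S, c e p • E p := by
    funext q b
    simp only [Finset.sum_apply, Pi.smul_apply, hE, smul_eq_mul, mul_ite, mul_one, mul_zero]
    by_cases hb : b = a
    · simp only [hb, and_true, if_true]
      rw [hcurl]
      refine Finset.sum_congr rfl fun e _ => ?_
      rw [Finset.sum_ite_eq Finset.univ q (fun p : ↥S => c e p), if_pos (Finset.mem_univ q)]
    · simp [hb]
  -- first term: linearity of `fderiv` in the direction and of the integral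
  have hA : (∫ U, fderiv ℝ g (YS U) (fun q b => if b = a then plaquetteCurl ω (q : ZdPlaquette 4) else 0) ∂μ) =
      ∑ e ∈ T, ω e * ∑ p : ↥S, c e p * ∫ U, fderiv ℝ g (YS U) (E p) ∂μ := by
    have hpt : ∀ U, fderiv ℝ g (YS U) (fun q b => if b = a then plaquetteCurl ω (q : ZdPlaquette 4) else 0) =
        ∑ e ∈ T, ω e * ∑ p : ↥S, c e p * fderiv ℝ g (YS U) (E p) := fun U => by
      rw [hvec]
      simp only [map_sum, map_smul, smul_eq_mul]
    simp_rw [hpt]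
    rw [integral_finsetSum _ fun e _ => (integrable_finsetSum _ fun p _ => (hEint p).const_mul _).const_mul _]
    refine Finset.sum_congr rfl fun e _ => ?_
    rw [integral_const_mul, integral_finsetSum _ fun p _ => (hEint p).const_mul _]
    refine congrArg _ (Finset.sum_congr rfl fun p _ => ?_)
    rw [integral_const_mul]
  -- second term
  have hB : (∫ U, g (YS U) * (∑ p ∈ S, plaquetteCurl ω p * plaqField r β U p a) ∂μ) =
      ∑ e ∈ T, ω e * ∫ U, g (YS U) * (∑ p ∈ S, c e p * plaqField r β U p a) ∂μ := by
    have hpt : ∀ U, g (YS U) * (∑ p ∈ S, plaquetteCurl ω p * plaqField r β U p a) =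
        ∑ e ∈ T, ω e * (g (YS U) * ∑ p ∈ S, c e p * plaqField r β U p a) := fun U => by
      simp only [hcurl, Finset.sum_mul, Finset.mul_sum]
      rw [Finset.sum_comm]
      exact Finset.sum_congr rfl fun e _ => Finset.sum_congr rfl fun p _ => by ring
    simp_rw [hpt]
    have hin : ∀ e, Integrable (fun U => g (YS U) * ∑ p ∈ S, c e p * plaqField r β U p a) μ := fun e => by
      have : (fun U => g (YS U) * ∑ p ∈ S, c e p * plaqField r β U p a) =
          fun U => ∑ p ∈ S, c e p * (g (YS U) * plaqField r β U p a) := by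
        funext U; rw [Finset.mul_sum]; exact Finset.sum_congr rfl fun p _ => by ring
      rw [this]
      exact integrable_finsetSum _ fun p _ => (hPint p).const_mul _
    rw [integral_finsetSum _ fun e _ => (hin e).const_mul _]
    exact Finset.sum_congr rfl fun e _ => integral_const_mul _ _
  -- resummation
  rw [hA, hB, ← Finset.sum_sub_distrib]
  calc |∑ e ∈ T, (ω e * ∑ p : ↥S, c e p * ∫ U, fderiv ℝ g (YS U) (E p) ∂μ -
          ω e * ∫ U, g (YS U) * (∑ p ∈ S, c e p * plaqField r β U p a) ∂μ)|
      ≤ ∑ e ∈ T, |ω e * ∑ p : ↥S, c e p * ∫ U, fderiv ℝ g (YS U) (E p) ∂μ -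
          ω e * ∫ U, g (YS U) * (∑ p ∈ S, c e p * plaqField r β U p a) ∂μ| := Finset.abs_sum_le_sum_abs _ _
    _ ≤ ∑ e ∈ T, |ω e| * R := by
        refine Finset.sum_le_sum fun e he => ?_
        rw [← mul_sub, abs_mul]
        exact mul_le_mul_of_nonneg_left (hsd e he) (abs_nonneg _)
    _ = (∑ e ∈ T, |ω e|) * R := by rw [Finset.sum_mul]

end Resum

section Packaged

variable {G : Type} [Group G] [TopologicalSpace G] [IsTopologicalGroup G] [CompactSpace G]
  [MeasurableSpace G] [BorelSpace G]

/-- **The resummed Schwinger–Dyson identity at rate** (`stub_sdRate` ∘ `sd_resum`): for every compact simple `G`, faithful unitary `r`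
and budget `E₀` there are `Csd ≥ 0`, `c`, `κsd > 0` (those of `stub_sdRate`) such that for `β ≥ 1`, every torus-limit state `μ` with
plaquette energies `β ∫(N − Re tr r(U_q)) dμ ≤ E₀`, every `1`-form `ω` supported in a finite edge set `T`, every colour `a`, every block
`S ⊇ plaquettesTouching T` inside the box of radius `ρS`, and every `C¹` block test `g` with `|g| ≤ 1`, `‖∇g‖ ≤ M`:
`|E_μ[∇g(Y_S) · v_{ω,a}] − E_μ[g(Y_S) · ∑_{p∈S} (dω)_p Y_p^a]| ≤ (∑_{e∈T} |ω e|) · Csd (1 + M) (1 + ρS)^c β^(−κsd)`. -/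
theorem sdRate_resummed (hG : IsCompactSimpleLieGroup G) (r : LatticeRep G) (E₀ : ℝ) :
    ∃ Csd c κsd : ℝ, 0 < κsd ∧ 0 ≤ Csd ∧ ∀ β : ℝ, 1 ≤ β →
      ∀ μ ∈ infiniteVolumeLimitPoints (d := 4) r.ρ β,
        (∀ (x : Site 4) (i j : Fin 4), i ≠ j → β * (∫ U, ((r.N : ℝ) - plaquetteObs r.ρ x i j U) ∂μ) ≤ E₀) →
        ∀ (ω : Literature.MathematicalPhysics.QuantumLattice.ZdEdge 4 → ℝ) (T : Finset (Literature.MathematicalPhysics.QuantumLattice.ZdEdge 4)),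
          (∀ e, ω e ≠ 0 → e ∈ T) →
          ∀ (a : Fin (lieDim r)) (S : Finset (ZdPlaquette 4)) (ρS : ℕ),
            plaquettesTouching T ⊆ S → (∀ p ∈ S, ∀ k : Fin 4, |p.1 k| ≤ (ρS : ℤ)) →
            ∀ (g : (↥S → Fin (lieDim r) → ℝ) → ℝ) (M : ℝ), 0 ≤ M → ContDiff ℝ 1 g →
              (∀ y, |g y| ≤ 1) → (∀ y, ‖fderiv ℝ g y‖ ≤ M) →
              |(∫ U, fderiv ℝ g (fun q b => plaqField r β U (q : ZdPlaquette 4) b)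
                    (fun q b => if b = a then plaquetteCurl ω (q : ZdPlaquette 4) else 0) ∂μ) -
                  ∫ U, g (fun q b => plaqField r β U (q : ZdPlaquette 4) b) *
                    (∑ p ∈ S, plaquetteCurl ω p * plaqField r β U p a) ∂μ| ≤
                (∑ e ∈ T, |ω e|) * (Csd * (1 + M) * (1 + (ρS : ℝ)) ^ c * β ^ (-κsd)) := by
  obtain ⟨Csd, c, κsd, hκ, hC, h⟩ := stub_sdRate G hG r E₀
  refine ⟨Csd, c, κsd, hκ, hC, ?_⟩
  intro β hβ μ hμ hE ω T hωT a S ρS hTS hρS g M hM hg hgb hgM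
  haveI : SecondCountableTopology G :=
    (r.continuous.isClosedEmbedding r.injective).isEmbedding.secondCountableTopology
  haveI : IsProbabilityMeasure μ := by
    obtain ⟨L, -, hP, -⟩ := hμ
    exact hP
  exact sd_resum r β μ S a ω T hωT g hg hgM fun e he =>
    h β hβ μ hμ hE e a S ρS ((plaquettesTouching_singleton_subset he).trans hTS) hρS g M hM hg hgb hgM

/-- **The resummed Schwinger–Dyson identity for a test on a sub-block** `B ⊆ S` (the form used with `g = ∂_{(p,a)}F ∘ restrict` in the
generator step): the same bound for `C¹` tests `g` of `Y_B`, the direction `v_{ω,a}` restricted to `B`, the weight `∑_{p∈S} (dω)_p Y_p^a`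
unchanged (composition with the coordinate restriction, a continuous linear map of norm `≤ 1`). -/
theorem sdRate_resummed_restrict (hG : IsCompactSimpleLieGroup G) (r : LatticeRep G) (E₀ : ℝ) :
    ∃ Csd c κsd : ℝ, 0 < κsd ∧ 0 ≤ Csd ∧ ∀ β : ℝ, 1 ≤ β →
      ∀ μ ∈ infiniteVolumeLimitPoints (d := 4) r.ρ β,
        (∀ (x : Site 4) (i j : Fin 4), i ≠ j → β * (∫ U, ((r.N : ℝ) - plaquetteObs r.ρ x i j U) ∂μ) ≤ E₀) →
        ∀ (ω : Literature.MathematicalPhysics.QuantumLattice.ZdEdge 4 → ℝ) (T : Finset (Literature.MathematicalPhysics.QuantumLattice.ZdEdge 4)),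
          (∀ e, ω e ≠ 0 → e ∈ T) →
          ∀ (a : Fin (lieDim r)) (S B : Finset (ZdPlaquette 4)), B ⊆ S → ∀ (ρS : ℕ),
            plaquettesTouching T ⊆ S → (∀ p ∈ S, ∀ k : Fin 4, |p.1 k| ≤ (ρS : ℤ)) →
            ∀ (g : (↥B → Fin (lieDim r) → ℝ) → ℝ) (M : ℝ), 0 ≤ M → ContDiff ℝ 1 g →
              (∀ y, |g y| ≤ 1) → (∀ y, ‖fderiv ℝ g y‖ ≤ M) →
              |(∫ U, fderiv ℝ g (fun q b => plaqField r β U (q : ZdPlaquette 4) b)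
                    (fun q b => if b = a then plaquetteCurl ω (q : ZdPlaquette 4) else 0) ∂μ) -
                  ∫ U, g (fun q b => plaqField r β U (q : ZdPlaquette 4) b) *
                    (∑ p ∈ S, plaquetteCurl ω p * plaqField r β U p a) ∂μ| ≤
                (∑ e ∈ T, |ω e|) * (Csd * (1 + M) * (1 + (ρS : ℝ)) ^ c * β ^ (-κsd)) := by
  obtain ⟨Csd, c, κsd, hκ, hC, h⟩ := sdRate_resummed hG r E₀
  refine ⟨Csd, c, κsd, hκ, hC, ?_⟩
  intro β hβ μ hμ hE ω T hωT a S B hBS ρS hTS hρS g M hM hg hgb hgM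
  -- the coordinate restriction `π : Y_S ↦ Y_B`
  let π : (↥S → Fin (lieDim r) → ℝ) →L[ℝ] (↥B → Fin (lieDim r) → ℝ) :=
    ContinuousLinearMap.pi fun q : ↥B =>
      ContinuousLinearMap.proj (R := ℝ) (φ := fun _ : ↥S => Fin (lieDim r) → ℝ) ⟨q.1, hBS q.2⟩
  have hπ : ∀ y, π y = fun q b => y ⟨q.1, hBS q.2⟩ b := fun y => rfl
  have hπ1 : ‖π‖ ≤ 1 := by
    refine ContinuousLinearMap.opNorm_le_bound π zero_le_one fun y => ?_
    rw [one_mul, hπ]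
    exact (pi_norm_le_iff_of_nonneg (norm_nonneg y)).2 fun q => norm_le_pi_norm y ⟨q.1, hBS q.2⟩
  -- the composed test function
  have hg' : ContDiff ℝ 1 (fun y => g (π y)) := hg.comp π.contDiff
  have hfd' : ∀ y, HasFDerivAt (fun y => g (π y)) ((fderiv ℝ g (π y)).comp π) y := fun y =>
    ((hg.differentiable one_ne_zero) (π y)).hasFDerivAt.comp y π.hasFDerivAt
  have hgM' : ∀ y, ‖fderiv ℝ (fun y => g (π y)) y‖ ≤ M := fun y => by
    rw [(hfd' y).fderiv]
    refine (ContinuousLinearMap.opNorm_comp_le _ _).trans ?_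
    have h1 := hgM (π y)
    have h2 := norm_nonneg (fderiv ℝ g (π y))
    nlinarith
  have key := h β hβ μ hμ hE ω T hωT a S ρS hTS hρS (fun y => g (π y)) M hM hg' (fun y => hgb _) hgM'
  have hderiv : ∀ U : LGConfig 4 G,
      fderiv ℝ (fun y => g (π y)) (fun q b => plaqField r β U (q : ZdPlaquette 4) b)
          (fun q b => if b = a then plaquetteCurl ω (q : ZdPlaquette 4) else 0) =
        fderiv ℝ g (fun q b => plaqField r β U (q : ZdPlaquette 4) b)
          (fun q b => if b = a then plaquetteCurl ω (q : ZdPlaquette 4) else 0) := fun U => by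
    rw [(hfd' _).fderiv, ContinuousLinearMap.comp_apply]
    rfl
  simp only [hderiv] at key
  exact key

end Packaged

end SdRate

end Summit.QuantumFields.YangMills.Cruxes.FreeProbeLawG.SteinFree

end
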